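import Literature.NumberTheory.EllipticCurves.PadicPointsFiniteIndexProofs
import Mathlib.Data.Nat.Factorization.Basic
import HarnessLib

/-!
# Every homomorphism `E(ℚ_p) → E'(ℚ_p)` maps deep levels of the formal filtration into deep levels

Topic `NumberTheory/EllipticCurves`; a proofs-only file (theorems only: no definitions, no named
facts).  Let `E, E'` be elliptic curves over `ℚ_p` with `p`-integral Weierstrass equations and
`f : E(ℚ_p) → E'(ℚ_p)` ANY additive map.  Then for every level `N'` there is a level `Ñ` with
`f(E⁽ᴺ̃⁾) ⊆ E'⁽ᴺ'⁾` (`WeierstrassCurve.exists_map_formalFiltration_le`): indeed `E'⁽ᴺ'⁾` has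
finite index `n` in `E'(ℚ_p)` (Silverman, *AEC*, VII.6.3; the tree's
`finiteIndex_formalFiltration`), so `n · E'(ℚ_p) ⊆ E'⁽ᴺ'⁾`, while `E⁽ᴺ̃⁾ ⊆ n · E⁽²⁾` as soon as
`Ñ ≥ 2 + v_p(n)` because `E⁽²⁾ ≅ p²ℤ_p` through the limit logarithm `L` (*AEC* IV.6.4, VII.6.3;
`WeierstrassCurve.exists_mem_padicLimitLog_eq`, `eq_zero_of_padicLimitLog_eq_zero`):
`WeierstrassCurve.formalFiltration_le_nsmul`.  In other words every abstract homomorphism between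
the Mordell–Weil groups of `p`-adic elliptic curves is continuous at `O` for the `p`-adic
topologies.  Used for the map on `ℚ_p`-points of an isogeny (sibling file
`IsogenyPadicLinearTermProofs`, towards Milne, *ADT*, Thm. I.7.3, step (V) at finite places), to
see a priori that it sends points close to `O` to points close to `O'`.

## References

* J. H. Silverman, *The Arithmetic of Elliptic Curves*, 2nd ed., GTM 106 (2009), IV.3.2, IV.6.4,
  VII.6.3. [SilvermanAEC2009]

## Design

Theorems only (D-0026); setting and notation of `PadicPointsFiltration{,Proofs}`.
-/

noncomputable section

open scoped Classical
open Literature.NumberTheory.EllipticCurves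

namespace WeierstrassCurve

variable {p : ℕ} [Fact p.Prime] (W : WeierstrassCurve ℚ_[p]) [hW : W.IsIntegral ℤ_[p]]
  [W.IsElliptic]

/-- `L(j • P) = j · L(P)` on `E⁽ⁿ⁾`, `n ≥ 2`. [Silverman AEC VII.6.3] [folklore] -/
theorem padicLimitLog_nsmul_of_mem {n : ℕ} (hn : 2 ≤ n) {P : W.toAffine.Point}
    (hP : P ∈ W.formalFiltration n) (j : ℕ) :
    W.padicLimitLog (j • P) = j * W.padicLimitLog P := by
  induction j with
  | zero => rw [zero_nsmul, W.padicLimitLog_zero, Nat.cast_zero, zero_mul]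
  | succ j ih =>
    rw [succ_nsmul, W.padicLimitLog_add_of_mem hn (AddSubgroup.nsmul_mem _ hP j) hP, ih,
      Nat.cast_succ]
    ring

/-- **`E⁽ᴺ⁺ᵛ⁾ ⊆ n · E⁽ᴺ⁾` for `v = v_p(n)`, `N ≥ 2`**: given `Q ∈ E⁽ᴺ⁺ᵛ⁾`, `L(Q)/n` has norm
`≤ p⁻ᴺ`, so it is `L(Q₀)` with `Q₀ ∈ E⁽ᴺ⁾`, and `L(n Q₀) = L(Q)` forces `n Q₀ = Q`
(`E⁽ᴺ⁾ ≅ pᴺ ℤ_p` via `L`, Silverman *AEC* VII.6.3). [cite: SilvermanAEC2009, VII.6.3] -/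
theorem formalFiltration_le_nsmul {N : ℕ} (hN : 2 ≤ N) {n : ℕ} (hn : n ≠ 0) {Q : W.toAffine.Point}
    (hQ : Q ∈ W.formalFiltration (N + padicValNat p n)) :
    ∃ Q₀ ∈ W.formalFiltration N, n • Q₀ = Q := by
  have hpR : (0 : ℝ) < p := by exact_mod_cast (Fact.out : p.Prime).pos
  set v := padicValNat p n with hv
  have hn0 : (n : ℚ_[p]) ≠ 0 := Nat.cast_ne_zero.mpr hn
  have hnorm_n : ‖(n : ℚ_[p])‖ = ((p : ℝ)⁻¹) ^ v := by
    rw [Padic.norm_eq_zpow_neg_valuation hn0, Padic.valuation_natCast, ← hv, inv_pow,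
      ← zpow_natCast, ← zpow_neg]
  have hQN : Q ∈ W.formalFiltration N := W.formalFiltration_antitone (Nat.le_add_right N v) hQ
  -- `t = L(Q)/n`
  set t : ℚ_[p] := W.padicLimitLog Q / n with ht
  have htN : ‖t‖ ≤ ((p : ℝ)⁻¹) ^ N := by
    rw [ht, norm_div, hnorm_n, div_le_iff₀ (pow_pos (inv_pos.mpr hpR) _), ← pow_add,
      W.norm_padicLimitLog_of_mem (le_trans hN (Nat.le_add_right N v)) hQ]
    exact hQ.2
  obtain ⟨Q₀, hQ₀, hL⟩ := W.exists_mem_padicLimitLog_eq hN htN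
  refine ⟨Q₀, hQ₀, ?_⟩
  have hnQ₀ : n • Q₀ ∈ W.formalFiltration N := AddSubgroup.nsmul_mem _ hQ₀ n
  have hLn : W.padicLimitLog (n • Q₀) = W.padicLimitLog Q := by
    rw [W.padicLimitLog_nsmul_of_mem hN hQ₀, hL, ht, mul_div_cancel₀ _ hn0]
  have h0 : W.padicLimitLog (n • Q₀ - Q) = 0 := by
    rw [W.padicLimitLog_sub_of_mem hN hnQ₀ hQN, hLn, sub_self]
  exact sub_eq_zero.mp (W.eq_zero_of_padicLimitLog_eq_zero hN (sub_mem hnQ₀ hQN) h0)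

variable {W} {W' : WeierstrassCurve ℚ_[p]} [hW' : W'.IsIntegral ℤ_[p]] [W'.IsElliptic]

/-- **Every additive map `f : E(ℚ_p) → E'(ℚ_p)` sends `E⁽ᴺ̃⁾` into `E'⁽ᴺ'⁾` for `Ñ ≫ 0`** (namely
`Ñ = 2 + v_p(n)`, `n = [E'(ℚ_p) : E'⁽ᴺ'⁾]`): `n · E'(ℚ_p) ⊆ E'⁽ᴺ'⁾` and `E⁽ᴺ̃⁾ ⊆ n · E⁽²⁾`.
In particular an isogeny acts continuously at `O` on `p`-adic points. Silverman, *AEC*, VII.6.3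
(finite index), IV.3.2. [cite: SilvermanAEC2009, VII.6.3] -/
theorem exists_map_formalFiltration_le (f : W.toAffine.Point →+ W'.toAffine.Point) (N' : ℕ) :
    ∃ Ñ : ℕ, (W.formalFiltration Ñ).map f ≤ W'.formalFiltration N' := by
  haveI := W'.finiteIndex_formalFiltration N'
  set n := (W'.formalFiltration N').index with hn
  have hn0 : n ≠ 0 := AddSubgroup.FiniteIndex.index_ne_zero
  refine ⟨2 + padicValNat p n, ?_⟩
  rintro _ ⟨Q, hQ, rfl⟩
  obtain ⟨Q₀, -, rfl⟩ := W.formalFiltration_le_nsmul le_rfl hn0 hQ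
  rw [map_nsmul]
  exact (W'.formalFiltration N').nsmul_index_mem (f Q₀)

end WeierstrassCurve
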